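import Summits.QuantumFields.BalabanUV.T4Continuum.Support.VariationalCovariantEnd

/-!
# T⁴ programme, spine node NE2 (U1a), lane P2 — THE SPLICED TOWER: the END of the variational route's background tier WITHOUT the
# nesting (COMP⁺) binders — consecutive levels' data ARBITRARY, the one-step data DEFINED from them by the phase-ratio trick, so that the
# TWO-RUNS tower `k ↦ X_k(U_k(V))` of the skeleton's root R is an INSTANCE of `towerLimitRate_scalarTower_closed` with node NE3's content
# sitting inside the CLASS bounds on the spliced one-step defects (road owner `b2b-balaban-t4-ne2-p2` gen 11; `t4/skeletons/NE2-t4-ne2-p2.md`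
# v0.9.1 §0 R / §2.C two-runs face / §7 (O1)–(O2); journal CLAIMS.log l.≈10100 (1), l.≈10135 NEXT)

HONEST FRAMING (T4-DAG p. 1).  Rung (B)+1 only — NOT infinite volume, NOT a mass gap, NOT Clay.  Node NE2 is NOT IN PRINT and NOT
proved here.  MODEL LEVEL: U(1) bond phases, unit-modulus site transports, global unitary frames and the defect data are DATA; scalar
(0-form) sector; global small field.  What is proved is [folklore] plumbing over `VariationalCovariantEnd.towerLimitRate_scalarTower_closed`
(p213959) and `VariationalCovariantTower.compT`/`Rtr` (leaf-02-g3 p213109): NO analytic content.  The READING «`Rc k, T k` = bond phases and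
composite contour transports of the k-level run's background `U_k(V)`; the spliced one-step defects `m_k`, `m₁,k` = run (k+1)'s own one-block
geometry PLUS the aligned distance between `U_k(V)` and `Q̄U_{k+1}(V)` (node NE3's currency, `T4EtaRateMin.LocalRate`; supplier leaf-09-g4's
`VariationalCovariantTwoRuns`, INTENT l.9875)» is NOT asserted here (no B0, no NE3).  Nothing printed is a hypothesis; no `def … : Prop` fact;
no `sorry`; axioms standard.  HONEST DEPENDENCY (cell, verbatim): continuum YM on T⁴ ⇐ BetaPertH ∧ nine spine estimates (0/9 proved);
BetaPertH ⇐ (D1) ∧ (D4) ∧ CAP+tail; G-an2-4 gates asym, D1 and NE2/3/4.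

CONTENTS.
* §1 `spliceR n L M S` (level-`n·L` bond phases read on the one-step torus `Tor (fine L (fine n M))` through `sites⁻¹`) and
  `spliceT n L M T S x = conj (T (blockOf x)) · S (sites⁻¹ x)` (the PHASE-RATIO one-step transport between ARBITRARY level-`n` transports `T`
  and level-`n·L` transports `S`); **`Rtr_spliceR : Rtr (spliceR S) = S`**, **`compT_spliceT : compT T (spliceT T S) = S`** (`‖T‖ = 1`),
  `norm_spliceT` (unimodular), `norm_spliceR_le` — i.e. the COMP⁺ identities of the END hold BY CONSTRUCTION for any two consecutive data.
* §2 **`towerLimitRate_spliced_closed`**: `towerLimitRate_scalarTower_closed` with `R′ k := spliceR (Rc (k+1))`, `T′ k := spliceT (T k) (T (k+1))`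
  — binders: unit-modulus `Rc k`, `T k` at EVERY level (no relation between levels), per-level frames for the coarse data and for the spliced
  one-step data, the spliced defects (`mis`, `hin`, `hcross`), `w_k`, `a_k`, CLASS, `2 ≤ L`, `0 < a₀` ⟹
  `TowerLimitRate (fun _ ↦ 1) 1 (k ↦ effSc (L^k) M (Rc k) (T k) a₀) (cEnd d L c_w c_a c_m c₁) L⁻¹`.  For NESTED data (one run's canonical
  tower, `T (k+1) = compT (T k) T′loc`) `spliceT (T k) (T (k+1)) = T′loc` and the defects are the run's own one-block geometry; for TWO RUNS
  the spliced transport is `(conj (T k y) · T̄ k y) · T′loc` (phase ratio of the two runs' level-k composite transports at the parent site `y`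
  times run (k+1)'s local one-step transport): `hin` is unchanged (the ratio cancels inside a block), `hcross`/`mis` acquire EXACTLY the
  aligned-connection distance of `VariationalCovariantLipschitz` between `(Rc k, T k)` and run (k+1)'s coarse partner — node NE3's input,
  which therefore enters the END ONLY through the CLASS bounds `n²·m_k ≤ c_m`, `n²·m₁,k ≤ c₁` (θ₃ = L⁻¹; a weaker NE3 rate needs the
  CLASS-θ variant of the END, not filed).
-/

noncomputable section

open scoped Matrix ComplexConjugate ComplexOrder Matrix.Norms.L2Operator BigOperators

namespace Summit.QuantumFields.BalabanUV.T4Continuum.VariationalCovariantSplice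

open Summit.QuantumFields.BalabanUV.T4Continuum.VariationalCovariantEffective (effSc)
open Summit.QuantumFields.BalabanUV.T4Continuum.VariationalCovariantTower (compT Rtr)
open Summit.QuantumFields.BalabanUV.T4Continuum.VariationalCovariantEnd (cEnd towerLimitRate_scalarTower_closed)
open Summit.QuantumFields.BalabanUV.T4Continuum.CovariantAveragingTower (TowerLimitRate)
open Summit.QuantumFields.BalabanUV.T4Continuum.VariationalCovariantFederbush (mis)
open Literature.MathematicalPhysics.QuantumFieldTheory.Balaban1983to89.B5Prop11Lower (nsq)
open Literature.MathematicalPhysics.QuantumFieldTheory.Balaban1983to89.B5Prop11Plancherel (Tor fine unitVec)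
open Literature.MathematicalPhysics.QuantumFieldTheory.Balaban1983to89.B5Block118 (bpt)
open Literature.MathematicalPhysics.QuantumFieldTheory.Balaban1983to89.B5Blocks16 (blockOf blockOf_bpt)
open Literature.MathematicalPhysics.QuantumFieldTheory.Balaban1983to89.B5Composition116 (sites)

/-! ## §1 The spliced one-step data -/

section Splice

variable {d : ℕ} (n L : ℕ) [NeZero n] [NeZero L] (M : Fin d → ℕ) [hM : ∀ μ, NeZero (M μ)]

/-- level-`n·L` bond phases `S` read as one-step data over the level-`n` torus (through `sites⁻¹`). [folklore] -/
def spliceR (S : Tor (fine (n * L) M) → Fin d → ℂ) (x : Tor (fine L (fine n M))) (μ : Fin d) : ℂ := S ((sites n L M).symm x) μ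

/-- the PHASE-RATIO one-step transport between arbitrary level-`n` site transports `T` and level-`n·L` site transports `S`:
`x ↦ conj (T (blockOf x)) · S (sites⁻¹ x)`. [folklore] -/
def spliceT (T : Tor (fine n M) → ℂ) (S : Tor (fine (n * L) M) → ℂ) (x : Tor (fine L (fine n M))) : ℂ :=
  conj (T (blockOf L (fine n M) x)) * S ((sites n L M).symm x)

omit [NeZero n] [NeZero L] hM in
/-- **COMP⁺ for the phases holds by construction**: `Rtr (spliceR S) = S`. [folklore] -/
theorem Rtr_spliceR (S : Tor (fine (n * L) M) → Fin d → ℂ) : Rtr n L M (spliceR n L M S) = S := by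
  funext x μ
  simp [Rtr, spliceR]

/-- **COMP⁺ for the transports holds by construction**: `compT T (spliceT T S) = S` for unimodular `T`. [folklore] -/
theorem compT_spliceT {T : Tor (fine n M) → ℂ} (hT : ∀ y, ‖T y‖ = 1) (S : Tor (fine (n * L) M) → ℂ) :
    compT n L M T (spliceT n L M T S) = S := by
  funext x
  simp only [compT, spliceT, Equiv.symm_apply_apply]
  have h : T (blockOf L (fine n M) (sites n L M x)) * conj (T (blockOf L (fine n M) (sites n L M x))) = 1 := by
    rw [Complex.mul_conj, Complex.normSq_eq_norm_sq, hT]; simp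
  calc T (blockOf L (fine n M) (sites n L M x)) * (conj (T (blockOf L (fine n M) (sites n L M x))) * S x)
      = (T (blockOf L (fine n M) (sites n L M x)) * conj (T (blockOf L (fine n M) (sites n L M x)))) * S x := by ring
    _ = S x := by rw [h, one_mul]

/-- the spliced transport is unimodular. [folklore] -/
theorem norm_spliceT {T : Tor (fine n M) → ℂ} (hT : ∀ y, ‖T y‖ = 1) {S : Tor (fine (n * L) M) → ℂ} (hS : ∀ x, ‖S x‖ = 1)
    (x : Tor (fine L (fine n M))) : ‖spliceT n L M T S x‖ = 1 := by
  rw [spliceT, norm_mul, Complex.norm_conj, hT, hS, one_mul]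

omit [NeZero n] [NeZero L] hM in
/-- the spliced phases are contractions if `S` is unimodular. [folklore] -/
theorem norm_spliceR_le {S : Tor (fine (n * L) M) → Fin d → ℂ} (hS : ∀ x μ, ‖S x μ‖ = 1) (x : Tor (fine L (fine n M))) (μ : Fin d) :
    ‖spliceR n L M S x μ‖ ≤ 1 := by
  rw [spliceR, hS]

end Splice

/-! ## §2 The END on the spliced tower: no nesting binders -/

section Spliced

variable {d : ℕ} (L : ℕ) [NeZero L] (M : Fin d → ℕ) [hM : ∀ μ, NeZero (M μ)]
variable (Rc : (k : ℕ) → Tor (fine (L ^ k) M) → Fin d → ℂ) (T : (k : ℕ) → Tor (fine (L ^ k) M) → ℂ)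
variable (G : (k : ℕ) → Tor (fine (L ^ k) M) → ℂ) (c : (k : ℕ) → Tor M → ℂ) (mG mB : ℕ → ℝ)
variable (G' : (k : ℕ) → Tor (fine L (fine (L ^ k) M)) → ℂ) (c' : (k : ℕ) → Tor (fine (L ^ k) M) → ℂ) (mG' mB' : ℕ → ℝ)
variable (m w a m₁ : ℕ → ℝ)

/-- **THE END ON THE SPLICED TOWER** (model level): ARBITRARY unit-modulus data `(Rc k, T k)` at every level `n = L^k` (NO relation between
consecutive levels assumed), the one-step data SPLICED from levels `k` and `k+1` (`spliceR (Rc (k+1))`, `spliceT (T k) (T (k+1))`), per-level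
global small-field frames for the coarse data and for the spliced one-step data, the spliced one-block mismatch `‖mis‖ ≤ m_k` (absorbed),
in-block defect `w_k`, plaquette defect `a_k`, spliced one-step defects `m₁,k`, and the CLASS bounds ⟹
`TowerLimitRate (fun _ ↦ 1) 1 (k ↦ effSc (L^k) M (Rc k) (T k) a₀) (cEnd d L c_w c_a c_m c₁) L⁻¹`.  For two runs the spliced defects carry
the aligned-connection distance between `U_k(V)` and `Q̄U_{k+1}(V)` (node NE3's currency) — a READING, not asserted; NE3 NOT discharged;
NE2 NOT proved. [folklore] -/
theorem towerLimitRate_spliced_closed (hL : 2 ≤ L)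
    (hT : ∀ k x, ‖T k x‖ = 1) (hRc1 : ∀ k y μ, ‖Rc k y μ‖ = 1)
    -- P⁺ data (global frames) for the level-k data and for the spliced one-step data
    (hG : ∀ k x, ‖G k x‖ = 1) (hc : ∀ k z, ‖c k z‖ ≤ 1)
    (hframe : ∀ k x μ, ‖G k (x + unitVec (fine (L ^ k) M) μ) - G k x * Rc k x μ‖ ≤ mG k)
    (hblock : ∀ k z j, ‖G k (bpt (L ^ k) M z j) - c k z * T k (bpt (L ^ k) M z j)‖ ≤ mB k)
    (hsmall : ∀ k, 16 * (d : ℝ) ^ 2 * ((((L ^ k : ℕ)) : ℝ) * mG k) ^ 2 + 4 * mB k ^ 2 ≤ 1 / 2)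
    (hG' : ∀ k x, ‖G' k x‖ = 1) (hc' : ∀ k y, ‖c' k y‖ ≤ 1)
    (hframe' : ∀ k x μ, ‖G' k (x + unitVec (fine L (fine (L ^ k) M)) μ) - G' k x * spliceR (L ^ k) L M (Rc (k + 1)) x μ‖ ≤ mG' k)
    (hblock' : ∀ k y j, ‖G' k (bpt L (fine (L ^ k) M) y j) - c' k y * spliceT (L ^ k) L M (T k) (T (k + 1)) (bpt L (fine (L ^ k) M) y j)‖
      ≤ mB' k)
    (hsmall' : ∀ k, 16 * (d : ℝ) ^ 2 * ((L : ℝ) * mG' k) ^ 2 + 4 * mB' k ^ 2 ≤ 1 / 2)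
    -- the SPLICED one-block mismatch (FED⁺), absorbed
    (hm : ∀ k, 0 ≤ m k)
    (hmis : ∀ k y μ j, ‖mis L (fine (L ^ k) M) (Rc k) (spliceR (L ^ k) L M (Rc (k + 1))) (spliceT (L ^ k) L M (T k) (T (k + 1))) y μ j‖ ≤ m k)
    (habsorb : ∀ k, 512 * (d : ℝ) ^ 2 * ((((L ^ k : ℕ)) : ℝ) * m k) ^ 2 ≤ 1 / 2)
    -- UB⁺ / REG⁺ data of the level-k data
    (hw : ∀ k, 0 ≤ w k)
    (hwin : ∀ k (y : Tor M) (j : Fin d → Fin (L ^ k)) (μ : Fin d), (j μ : ℕ) + 1 < L ^ k →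
      ‖Rc k (bpt (L ^ k) M y j) μ * (starRingEnd ℂ) (T k (bpt (L ^ k) M y j + unitVec (fine (L ^ k) M) μ)) * T k (bpt (L ^ k) M y j) - 1‖
        ≤ w k)
    (ha : ∀ k, 0 ≤ a k)
    (hP : ∀ k x μ ν, ‖Rc k x μ * Rc k (x + unitVec (fine (L ^ k) M) μ) ν - Rc k x ν * Rc k (x + unitVec (fine (L ^ k) M) ν) μ‖ ≤ a k)
    -- the SPLICED one-step defects (ONE⁺)
    (hm₁ : ∀ k, 0 ≤ m₁ k)
    (hin : ∀ k (y : Tor (fine (L ^ k) M)) (j : Fin d → Fin L) (μ : Fin d), (j μ : ℕ) + 1 < L →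
      ‖spliceR (L ^ k) L M (Rc (k + 1)) (bpt L (fine (L ^ k) M) y j) μ
          * (starRingEnd ℂ) (spliceT (L ^ k) L M (T k) (T (k + 1)) (bpt L (fine (L ^ k) M) y j + unitVec (fine L (fine (L ^ k) M)) μ))
          * spliceT (L ^ k) L M (T k) (T (k + 1)) (bpt L (fine (L ^ k) M) y j) - 1‖ ≤ m₁ k)
    (hcross : ∀ k (y : Tor (fine (L ^ k) M)) (j : Fin d → Fin L) (μ : Fin d), (j μ : ℕ) + 1 = L →
      ‖spliceR (L ^ k) L M (Rc (k + 1)) (bpt L (fine (L ^ k) M) y j) μ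
          * (starRingEnd ℂ) (spliceT (L ^ k) L M (T k) (T (k + 1)) (bpt L (fine (L ^ k) M) y j + unitVec (fine L (fine (L ^ k) M)) μ))
          * spliceT (L ^ k) L M (T k) (T (k + 1)) (bpt L (fine (L ^ k) M) y j) - Rc k y μ‖ ≤ m₁ k)
    -- CLASS
    {cw ca cm c₁ : ℝ}
    (hwc : ∀ k, (((L ^ k : ℕ)) : ℝ) * w k ≤ cw) (hac : ∀ k, a k * (((L ^ k : ℕ)) : ℝ) ^ 2 ≤ ca)
    (hmc : ∀ k, (((L ^ k : ℕ)) : ℝ) ^ 2 * m k ≤ cm) (hm₁c : ∀ k, (((L ^ k : ℕ)) : ℝ) ^ 2 * m₁ k ≤ c₁)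
    {a₀ : ℝ} (ha₀ : 0 < a₀) :
    TowerLimitRate (ι := fun _ => Tor M) (fun _ => (1 : Matrix (Tor M) (Tor M) ℂ)) 1
      (fun k => effSc (L ^ k) M (Rc k) (T k) a₀) (cEnd d L cw ca cm c₁) ((L : ℝ)⁻¹) :=
  towerLimitRate_scalarTower_closed L M Rc T (fun k => spliceR (L ^ k) L M (Rc (k + 1)))
    (fun k => spliceT (L ^ k) L M (T k) (T (k + 1))) G c mG mB G' c' mG' mB' m w a m₁ hL hT hRc1
    (fun k x μ => norm_spliceR_le (L ^ k) L M (hRc1 (k + 1)) x μ) (fun k x => norm_spliceT (L ^ k) L M (hT k) (hT (k + 1)) x)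
    (fun k => (compT_spliceT (L ^ k) L M (hT k) (T (k + 1))).symm) (fun k => (Rtr_spliceR (L ^ k) L M (Rc (k + 1))).symm)
    hG hc hframe hblock hsmall hG' hc' hframe' hblock' hsmall' hm hmis habsorb hw hwin ha hP hm₁ hin hcross hwc hac hmc hm₁c ha₀

end Spliced

end Summit.QuantumFields.BalabanUV.T4Continuum.VariationalCovariantSplice

end
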